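import Summits.BirchSwinnertonDyer.Rank2.LevelFifteenExactSymbols
import Literature.NumberTheory.EllipticCurves.PAdicLFunctionIntegralityAtTwoProofs
import HarnessLib

/-!
# Manin symbols on `Γ₀(15)`, V: the Mazur–Tate Riemann sums of `L₂(15A8)` in CLOSED FORM (integer tables)

Cell `bsd-rank2` (D-0036), seat `bsd-rank2-eng` GEN 9 (director-bsd g9 ruling (R3): BC5 rung «(★_S) mod T⁸ on 15A8»,
line `star`, crux E1M stmt-BirchSwinnertonDyer-20341; Stage B of the rung, continued). Parts III–IV give the exact plus
symbols `[a/c]⁺ = −s/8 + s·(descent c d).1/2` of the newforms of `15A8`. Here they are fed into the tree's Riemann sums of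
the `2`-adic `L`-function (`padicLRiemannSum`, whose `k`-th limit is the `k`-th coefficient `c_k` of `L₂(f, α, T)`;
`padicLRiemannSum_two`: `RS(k, n) = 2·Σ_{s<2ⁿ} μ(5ˢ + 2ⁿ⁺²ℤ₂)·C(s,k)`):

* computable integer data: `dyadD a j` (a `d ≡ 0 (mod 15)` with `a·d ≡ 1 (mod 2ʲ)`), `dyadB`, the Bézout identity
  `bezout_dyadD` (`a·dyadD − dyadB·2ʲ = 1` for odd `a`), `nOne a j = (descent 2ʲ (dyadD a j)).1` = the exact `E₁`-coordinate of
  `{0, a/2ʲ}`, and the two INTEGER TABLES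
  `riemannA k n = Σ_{s<2ⁿ} (4·nOne(5ˢ mod 2ⁿ⁺², n+2) − 1)·C(s,k)`, `riemannB k n = Σ_{s<2ⁿ} (1 − 4·nOne(5ˢ mod 2ⁿ⁺², n+1))·C(s,k)`
  (written with `sumBelow`/`chooseFast`, primitive-recursive, kernel-evaluable);
* **`padicLRiemannSum_refFifteen_eq`** — for every newform `f` of `[1,1,1,0,0]` and every `α ≠ 0`:
  `RS(k, n) = s · α⁻ⁿ⁻³ · (α·riemannA k n + riemannB k n) / 4` in `ℚ₂` (`s = ±1` the sign of part IV), an identity with NO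
  limit and NO error term — the whole analytic input of `L₂(15A8)` modulo `(4, T⁸)` is now two integer tables plus `α`;
* `riemann_tables_four`, `riemann_tables_six` — the tables at `n = 4` (`k ≤ 3`) and `n = 6` (`k ≤ 5`) by `decide +kernel`
  (the precision the tree's truncation bound with `‖μ‖ ≤ 2` asks for `c₀,…,c₅ mod 4`; `α ≡ 37 (mod 128)` is left to the sequel).

Numerics (seat folder `tools/l15.py`, `tools/star_check15.py`, a Python port of `descent` validated against the kernel
values of part III): with `α ≡ 37 (mod 128)` the tables give `L₂(f,α)/2 ≡ s·(1 + T³ + T⁴ + T⁶ + T⁹ + T¹⁰ + T¹⁵ + …) (mod 2)`,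
stable from `n = 4`, and `T²·(L₂/2)‾ = (1+T)·ḡ·ḡ^ι·(1 − ⟨3⟩⁻¹)(1 − ⟨5⟩⁻¹) (mod 2, T¹⁶)` — p2 GEN 19's (★) for the class 15a,
reproduced from the tree's own symbols (not from PARI).

DEFINITIONS + THEOREMS (computable `def`s only; no named fact, no `sorry`). PARTITION: none — r_an ≥ 2, summit axis S0; TWIN
(D-0056): n/a. B1 honesty: finite modular-symbol arithmetic; nothing here reads an analytic rank; no S0 motion.

References: B. Mazur, J. Tate, J. Teitelbaum, *Invent. Math.* 84 (1986) §I.10–§I.13 [MazurTateTeitelbaum1986Invent];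
J. E. Cremona, *Algorithms for modular elliptic curves* (1997) §2.8 [CremonaAlgorithms1997].
-/

open scoped MatrixGroups ModularForm

namespace Summit.BirchSwinnertonDyer.Rank2.LevelFifteen

/-! ### §1 Computable data (kernel-friendly: structural recursion, `pow`, `div`, `mod` only) -/

/-- `Σ_{s<m} F(s)` by primitive recursion (kernel-friendly form of `∑ s ∈ range m, F s`, `sumBelow_eq_sum_range`). [folklore] -/
def sumBelow (F : ℕ → ℤ) : ℕ → ℤ
  | 0 => 0
  | m + 1 => sumBelow F m + F m

/-- The binomial coefficient through the falling factorial, `C(s,k) = s(s−1)⋯(s−k+1)/k!` (`chooseFast_eq_choose`). [folklore] -/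
def chooseFast (s k : ℕ) : ℕ := s.descFactorial k / k.factorial

/-- `u_j = (14·16ʲ + 1)/15`, an inverse of `15` modulo `2ʲ` (`15·u_j = 14·16ʲ + 1`). [folklore] -/
def inv15Pow2 (j : ℕ) : ℕ := (14 * 16 ^ j + 1) / 15

/-- For `s ≤ 2ʲ`: `d = 15·u_j·5^{2ʲ−s}`, an integer `≡ 0 (mod 15)` with `5ˢ·d ≡ 1 (mod 2ʲ)` (`5^{2ʲ} ≡ 1`). [folklore] -/
def dyadDS (s j : ℕ) : ℤ := ((15 * inv15Pow2 j * 5 ^ (2 ^ j - s) : ℕ) : ℤ)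

/-- The Bézout cofactor `b = (a·d − 1)/2ʲ`. [folklore] -/
def dyadBS (a : ℤ) (s j : ℕ) : ℤ := (a * dyadDS s j - 1) / 2 ^ j

/-- The exact `E₁`-coordinate `n₁(5ˢ, j)` of the closed cycle `{0, 5ˢ/2ʲ}` on `X₀(15)` (`s ≤ 2ʲ`): the first component of
`descent 2ʲ (dyadDS s j)` (part III). [cite: Manin1972, Thm. 1.6] -/
def nOneS (s j : ℕ) : ℤ := (descent (2 ^ j) (dyadDS s j)).1

/-- Integer table `A(k, n) = Σ_{s<2ⁿ} (4·n₁(5ˢ, n+2) − 1)·C(s,k)`. [cite: MazurTateTeitelbaum1986Invent, §I.13] -/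
def riemannA (k n : ℕ) : ℤ :=
  sumBelow (fun s ↦ (4 * nOneS s (n + 2) - 1) * (chooseFast s k : ℤ)) (2 ^ n)

/-- Integer table `B(k, n) = Σ_{s<2ⁿ} (1 − 4·n₁(5ˢ, n+1))·C(s,k)`. [cite: MazurTateTeitelbaum1986Invent, §I.13] -/
def riemannB (k n : ℕ) : ℤ :=
  sumBelow (fun s ↦ (1 - 4 * nOneS s (n + 1)) * (chooseFast s k : ℤ)) (2 ^ n)

/-- The tables at `n = 4`, `k ≤ 3` (kernel evaluation). [folklore] -/
theorem riemann_tables_four :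
    riemannA 0 4 = -8 ∧ riemannB 0 4 = 0 ∧ riemannA 1 4 = -72 ∧ riemannB 1 4 = -72 ∧
    riemannA 2 4 = -240 ∧ riemannB 2 4 = -560 ∧ riemannA 3 4 = -660 ∧ riemannB 3 4 = -2500 := by
  decide +kernel

/-- The tables at `n = 6`, `k ≤ 5` (64 summands; kernel evaluation) — the precision the tree's truncation bound
`norm_padicLCoeff_sub_padicLRiemannSum_le` (with `‖μ‖ ≤ 2`) asks for the coefficients `c₀,…,c₅` modulo `4`. [folklore] -/
theorem riemann_tables_six :
    riemannA 0 6 = 8 ∧ riemannB 0 6 = -16 ∧ riemannA 1 6 = 2320 ∧ riemannB 1 6 = -768 ∧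
    riemannA 2 6 = 66528 ∧ riemannB 2 6 = -17152 ∧ riemannA 3 6 = 1089880 ∧ riemannB 3 6 = -284448 ∧
    riemannA 4 6 = 12848760 ∧ riemannB 4 6 = -3640944 ∧ riemannA 5 6 = 119265504 ∧ riemannB 5 6 = -37675232 := by
  decide +kernel

noncomputable section

open CongruenceSubgroup Matrix.SpecialLinearGroup ModularGroup
open Literature.NumberTheory.EllipticCurves Literature.NumberTheory.EllipticCurves.ModularForms

/-! ### §2 Elementary identities for the data -/

/-- `sumBelow F m = Σ_{s ∈ range m} F s`. [folklore] -/
theorem sumBelow_eq_sum_range (F : ℕ → ℤ) (m : ℕ) : sumBelow F m = ∑ s ∈ Finset.range m, F s := by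
  induction m with
  | zero => simp [sumBelow]
  | succ m ih => rw [sumBelow, ih, Finset.sum_range_succ]

/-- `chooseFast s k = C(s, k)`. [folklore] -/
theorem chooseFast_eq_choose (s k : ℕ) : chooseFast s k = s.choose k :=
  (Nat.choose_eq_descFactorial_div_factorial s k).symm

/-- `15 ∣ dyadDS s j`. [folklore] -/
theorem fifteen_dvd_dyadDS (s j : ℕ) : (15 : ℤ) ∣ dyadDS s j :=
  ⟨(inv15Pow2 j * 5 ^ (2 ^ j - s) : ℕ), by unfold dyadDS; push_cast; ring⟩

/-- `15·u_j = 14·16ʲ + 1`. [folklore] -/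
theorem fifteen_mul_inv15Pow2 (j : ℕ) : 15 * inv15Pow2 j = 14 * 16 ^ j + 1 := by
  have h : 15 ∣ 14 * 16 ^ j + 1 := by
    have h16 : 16 ^ j % 15 = 1 := by
      rw [Nat.pow_mod]; simp
    omega
  unfold inv15Pow2
  exact Nat.mul_div_cancel' h

/-- `2ʲ ∣ 5^{2ʲ} − 1`. [folklore] -/
theorem two_pow_dvd_five_pow_two_pow_sub_one (j : ℕ) : (2 : ℤ) ^ j ∣ 5 ^ (2 ^ j) - 1 := by
  induction j with
  | zero => norm_num
  | succ j ih =>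
    have hfac : (5 : ℤ) ^ (2 ^ (j + 1)) - 1 = (5 ^ (2 ^ j) - 1) * (5 ^ (2 ^ j) + 1) := by
      rw [pow_succ, pow_mul]; ring
    have ho : Odd ((5 : ℤ) ^ (2 ^ j)) := Odd.pow (by decide)
    have h2 : (2 : ℤ) ∣ 5 ^ (2 ^ j) + 1 := even_iff_two_dvd.mp (ho.add_odd odd_one)
    rw [hfac, pow_succ]
    exact mul_dvd_mul ih h2

/-- **Bézout**: for `s ≤ 2ʲ` and `a ≡ 5ˢ (mod 2ʲ)`, `a·dyadDS s j − dyadBS a s j·2ʲ = 1`. [folklore] -/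
theorem bezout_dyadDS {a : ℤ} {s j : ℕ} (hs : s ≤ 2 ^ j) (ha : a ≡ 5 ^ s [ZMOD 2 ^ j]) :
    a * dyadDS s j - dyadBS a s j * 2 ^ j = 1 := by
  have hdvd : (2 : ℤ) ^ j ∣ a * dyadDS s j - 1 := by
    have h15 : (15 : ℤ) * (inv15Pow2 j : ℕ) ≡ 1 [ZMOD 2 ^ j] := by
      have h := fifteen_mul_inv15Pow2 j
      have h' : (15 : ℤ) * (inv15Pow2 j : ℕ) = 14 * 16 ^ j + 1 := by exact_mod_cast h
      rw [Int.modEq_iff_dvd, h']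
      refine ⟨-(14 * 8 ^ j), ?_⟩
      rw [show (16 : ℤ) = 2 * 8 by norm_num, mul_pow]; ring
    have hpow : (5 : ℤ) ^ (2 ^ j) ≡ 1 [ZMOD 2 ^ j] := by
      rw [Int.modEq_iff_dvd, ← dvd_neg, neg_sub]
      exact two_pow_dvd_five_pow_two_pow_sub_one j
    have hsw : s + (2 ^ j - s) = 2 ^ j := Nat.add_sub_cancel' hs
    have hprod : a * dyadDS s j ≡ 1 [ZMOD 2 ^ j] := by
      have e : a * dyadDS s j = a * ((15 : ℤ) * (inv15Pow2 j : ℕ)) * (5 : ℤ) ^ (2 ^ j - s) := by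
        unfold dyadDS; push_cast; ring
      rw [e]
      have step : a * ((15 : ℤ) * (inv15Pow2 j : ℕ)) * (5 : ℤ) ^ (2 ^ j - s) ≡
          5 ^ s * 1 * (5 : ℤ) ^ (2 ^ j - s) [ZMOD 2 ^ j] := (ha.mul h15).mul_right _
      refine step.trans ?_
      rw [mul_one, ← pow_add, hsw]
      exact hpow
    exact Int.modEq_iff_dvd.mp hprod.symm
  rw [dyadBS, Int.ediv_mul_cancel hdvd]
  ring

/-- `((5ˢ mod 2^{n+2}) : ℤ) ≡ 5ˢ (mod 2ʲ)` for `j ≤ n + 2`. [folklore] -/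
theorem pow_mod_modEq {s n j : ℕ} (hj : j ≤ n + 2) :
    (((5 ^ s % 2 ^ (n + 2) : ℕ)) : ℤ) ≡ 5 ^ s [ZMOD 2 ^ j] := by
  have h : (5 ^ s % 2 ^ (n + 2)) % 2 ^ j = 5 ^ s % 2 ^ j := Nat.mod_mod_of_dvd _ (pow_dvd_pow 2 hj)
  have h' := congrArg (fun x : ℕ ↦ (x : ℤ)) h
  push_cast at h'
  exact h'

/-- A sum over `ZMod (2ⁿ)` of a function of the representative is the sum over `range 2ⁿ`. [folklore] -/
theorem sum_zmod_val_eq_sum_range {M : Type*} [AddCommMonoid M] (n : ℕ) (G : ℕ → M) :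
    ∑ s : ZMod (2 ^ n), G s.val = ∑ m ∈ Finset.range (2 ^ n), G m := by
  refine Finset.sum_nbij' (fun x : ZMod (2 ^ n) ↦ x.val) (fun m : ℕ ↦ (m : ZMod (2 ^ n))) ?_ ?_ ?_ ?_ ?_
  · intro x _; exact Finset.mem_range.mpr (ZMod.val_lt x)
  · intro m _; exact Finset.mem_univ _
  · intro x _; exact ZMod.natCast_zmod_val x
  · intro m hm; exact ZMod.val_cast_of_lt (Finset.mem_range.mp hm)
  · intro x _; rfl

/-! ### §3 The Riemann sums of `L₂(15A8)` in closed form -/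

/-- **Closed form of the Mazur–Tate Riemann sums of `15A8` at `p = 2`.** For every newform `f` of `[1,1,1,0,0]` there is a
sign `s ∈ {1, −1}` (that of part IV: `[0]⁺_f = −s/8`) such that for every `α ∈ ℚ₂`, `α ≠ 0`, and all `k, n`:
`padicLRiemannSum f α k n = s · α⁻¹ⁿ⁺³ · (α·riemannA k n + riemannB k n)/4`. Proof: `padicLRiemannSum_two` (the `Δ = {±1}`
doubling), `msdMeasure f α (n+2) a = α⁻¹ⁿ⁺²[a/2ⁿ⁺²]⁺ − α⁻¹ⁿ⁺³[a/2ⁿ⁺¹]⁺`, the exact symbols of part IV at the cusps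
`(5ˢ mod 2ⁿ⁺²)/2ʲ` with the Bézout data `dyadDS/dyadBS`, and bookkeeping of the finite sums.
[cite: MazurTateTeitelbaum1986Invent, §I.10 (10.1), §I.13] -/
theorem padicLRiemannSum_refFifteen_eq ⦃N : ℕ⦄ [NeZero N] (f : CuspForm (Gamma0 N) 2)
    (hW : IsNewformOf (⟨1, 1, 1, 0, 0⟩ : WeierstrassCurve ℚ) f) :
    ∃ σ : ℤ, (σ = 1 ∨ σ = -1) ∧ ratPlusSymbol f 0 = -(σ : ℚ) / 8 ∧
      ∀ (α : ℚ_[2]), α ≠ 0 → ∀ k n : ℕ,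
        padicLRiemannSum f α k n =
          (σ : ℚ_[2]) * α⁻¹ ^ (n + 3) * ((α * (riemannA k n : ℚ_[2]) + (riemannB k n : ℚ_[2])) / 4) := by
  obtain ⟨σ, hσ, h0, hlaw⟩ := ratPlusSymbol_refFifteen_exact f hW
  refine ⟨σ, hσ, h0, fun α hα k n ↦ ?_⟩
  -- the exact symbols at the dyadic cusps met by the Riemann sums
  have hsymb : ∀ (m j : ℕ), m < 2 ^ n → j ≤ n + 2 → n + 1 ≤ j →
      ratPlusSymbol f (((5 ^ m % 2 ^ (n + 2) : ℕ) : ℚ) / (2 : ℚ) ^ j) =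
        -(σ : ℚ) / 8 + ((σ * nOneS m j : ℤ) : ℚ) / 2 := by
    intro m j hm hj hj'
    have hm' : m ≤ 2 ^ j := by
      have : 2 ^ n ≤ 2 ^ j := Nat.pow_le_pow_right (by norm_num) (by omega)
      omega
    have hbez := bezout_dyadDS hm' (pow_mod_modEq (s := m) hj)
    have h := hlaw ((5 ^ m % 2 ^ (n + 2) : ℕ) : ℤ) (dyadBS ((5 ^ m % 2 ^ (n + 2) : ℕ) : ℤ) m j) ((2 : ℤ) ^ j)
      (dyadDS m j) (by linear_combination hbez) (by positivity) (fifteen_dvd_dyadDS m j)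
    have hcast : ((((5 ^ m % 2 ^ (n + 2) : ℕ) : ℤ) : ℚ) / (((2 : ℤ) ^ j : ℤ) : ℚ)) =
        ((5 ^ m % 2 ^ (n + 2) : ℕ) : ℚ) / (2 : ℚ) ^ j := by
      simp only [Int.cast_natCast, Int.cast_pow, Int.cast_ofNat]
    rw [hcast] at h
    rw [h]
    rfl
  -- each summand in closed form
  have hαpow : α⁻¹ ^ (n + 2) = α * α⁻¹ ^ (n + 3) := by
    rw [eq_comm, pow_succ', ← mul_assoc, mul_inv_cancel₀ hα, one_mul]
  have hterm : ∀ s : ZMod (2 ^ n),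
      msdMeasure f α (n + 2) ((cyclotomicGenerator 2 : ZMod (2 ^ (n + 2))) ^ s.val) * (s.val.choose k : ℚ_[2]) =
        (σ : ℚ_[2]) * α⁻¹ ^ (n + 3) / 8 *
          (α * (((4 * nOneS s.val (n + 2) - 1) * (chooseFast s.val k : ℤ) : ℤ) : ℚ_[2]) +
            (((1 - 4 * nOneS s.val (n + 1)) * (chooseFast s.val k : ℤ) : ℤ) : ℚ_[2])) := by
    intro s
    have hval : ((cyclotomicGenerator 2 : ZMod (2 ^ (n + 2))) ^ s.val).val = 5 ^ s.val % 2 ^ (n + 2) := by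
      rw [← Nat.cast_pow, ZMod.val_natCast, cyclotomicGenerator_two]
    have hs := ZMod.val_lt s
    have h2 := hsymb s.val (n + 2) hs le_rfl (by omega)
    have h1 := hsymb s.val (n + 1) hs (by omega) le_rfl
    have hcast2 : ((2 : ℕ) : ℚ) = (2 : ℚ) := by norm_num
    simp only [msdMeasure, show n + 1 + 1 = n + 2 from rfl, show n + 1 + 2 = n + 3 from rfl]
    rw [hval, hcast2, h2, h1, chooseFast_eq_choose]
    push_cast
    linear_combination ((σ : ℚ_[2]) * (4 * (nOneS s.val (n + 2) : ℚ_[2]) - 1) * (s.val.choose k : ℚ_[2]) / 8) * hαpow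
  rw [padicLRiemannSum_two, Finset.sum_congr rfl fun s _ ↦ hterm s, ← Finset.mul_sum, Finset.sum_add_distrib,
    ← Finset.mul_sum]
  -- identify the two integer sums
  have hA : ∑ s : ZMod (2 ^ n), ((((4 * nOneS s.val (n + 2) - 1) * (chooseFast s.val k : ℤ) : ℤ)) : ℚ_[2]) =
      (riemannA k n : ℚ_[2]) := by
    rw [sum_zmod_val_eq_sum_range n (fun m ↦ ((((4 * nOneS m (n + 2) - 1) * (chooseFast m k : ℤ) : ℤ)) : ℚ_[2])),
      riemannA, sumBelow_eq_sum_range]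
    push_cast
    rfl
  have hB : ∑ s : ZMod (2 ^ n), ((((1 - 4 * nOneS s.val (n + 1)) * (chooseFast s.val k : ℤ) : ℤ)) : ℚ_[2]) =
      (riemannB k n : ℚ_[2]) := by
    rw [sum_zmod_val_eq_sum_range n (fun m ↦ ((((1 - 4 * nOneS m (n + 1)) * (chooseFast m k : ℤ) : ℤ)) : ℚ_[2])),
      riemannB, sumBelow_eq_sum_range]
    push_cast
    rfl
  rw [hA, hB]
  ring

end

end Summit.BirchSwinnertonDyer.Rank2.LevelFifteen
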